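import Literature.Probability.FitznerVanDerHofstad2017.SawCountTables
import HarnessLib

set_option Elab.async false  -- one kernel evaluation at a time (bounded memory on the farm)

/-!
# Kernel-certified SAW end-point counts `c_n(x)` on `ℤ^d`, uniformly in `d` — `c_10(x)`, `x ∼ (1,1,1,1)` (completes `n ≤ 10` for the 19 stage-1 point types) — part 15/16

Continuation of `SawCountTables` (see there for the method and references): the ten-step class `x ∼ (1,1,1,1)` — with it every entry `n ≤ 10` of the `d = 11` stage-1 SAW table is a kernel theorem. Part 15 of 16: self-contained kernel pieces (leaf evaluations) only — the parts a, b, c, d, e, f, g, h, i, j, k, l, m, n, o are independent of each other; part p assembles them into the theorem.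
Each coefficient is one `decide +kernel` evaluation of `sawCodeF`; no facts, no hypotheses beyond `s ≤ d`.
-/

namespace Literature.Probability.FitznerVanDerHofstad2017

open Finset Literature.Probability.LatticeModels Literature.Probability.Percolation

variable {d : ℕ}

/-! #### Kernel pieces for `card_sawWordsTo_n10_x1111` (part 15) -/

set_option maxHeartbeats 0 in
/-- Kernel piece (child) (38891 nodes). [folklore] -/
theorem card_sawWordsTo_n10_x1111_k1027 : freshChild 8 2 5 9824920946709367278147681 5 (nextV 9824920946709367261370465 0) [9824920946709367261370465] = 12864 := by
  decide +kernel

end Literature.Probability.FitznerVanDerHofstad2017
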